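import Literature.AlgebraicGeometry.Motives.IntegralModelReductionMap
import Literature.RingTheory.Flat.SpecialFibreClosedPointGenerization
import Literature.NumberTheory.GaloisRepresentations.AlgebraicDomainPlaceFromEmbedding
import HarnessLib

/-!
# The reduction map of a PROPER FLAT model hits every closed point of the special fibre
# ([Liu2002] Prop. 10.1.36 / Cor. 10.1.38 «`X⁰ → 𝒳_s` is surjective onto the closed points»; [EGAIV3] 14.5.3)

Topic `Literature/AlgebraicGeometry/Motives`; THEOREMS ONLY (no definition, no named fact, no instance, no notation; net Literature debt 0).
Cell `hodgecm-mathlib` (D-0151), FLOOR-0 programme P5a (D9op), ED. 4 of `Cruxes/HLiu418/Lines/F0_D9opRoad2.lean`, letter `stub_H` in its consumed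
form («the reduction map `red_𝒳 : X(Ω) → 𝒳_v(κ̄(v))` of a proper flat model is surjective», road (b)): this file is piece **(b3a)** — surjectivity
ONTO CLOSED POINTS (the two `κ̄(v)`-points over a closed point then differ by `Aut(κ̄(v)/κ(v))`, ★ `AlgPoints.exists_algEquiv_smul_eq_of_pt_eq`;
the Galois twist producing the prescribed `κ̄(v)`-point is piece (b3b), filed with the Frobenius-lift letter `stub_Fr`).

Route ([Liu2002] §10.1.3): for a `κ̄(v)`-point `z` of `𝒳_v` with closed point `x̃ = fst(z.pt)` of the total space (closed: `κ(x̃) ⊆ κ̄(v)` is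
algebraic — `AlgPoints.isClosed_singleton_pt_of_isAlgebraic` via `IsIntegralHom.of_comp`), take an affine open `U = Spec A ∋ x̃`; `A` is of finite
type (★ Mathlib `HasRingHomProperty.appLE` for `LocallyOfFiniteType`) and flat (same for `Flat`) over `𝓞ᵥ`, so `ϖ ∈ 𝔪ᵥ` is `A`-regular; `x̃ ↔ 𝔫`
maximal with `𝔪ᵥ A ⊆ 𝔫` (`IsAffineOpen.comap_primeIdealOf_appLE` + the `Spec 𝓞ᵥ`-stalk is `(𝓞ᵥ)_𝔭`); ★ (b1) p794118
`Literature.RingTheory.Flat.exists_prime_le_isAlgebraic_quotient` gives a prime `q ≤ 𝔫`, `ϖ ∉ q`, `A ⧸ q` ALGEBRAIC over `𝓞ᵥ`; ★ (b2, prime form)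
`exists_ringHom_closureValuationSubring_comap_eq` gives `e : A ⧸ q → R = 𝒪_{\bar K_v}` over `𝓞ᵥ` with centre `𝔫 ⧸ q`; `ρ = Spec (e ∘ (A → A⧸q)) ≫ (U ↪ 𝒳)`
is an `R`-point over `𝓞ᵥ` through `x̃` (`SpecMap_appLE_fromSpec`, `fromSpec_primeIdealOf`); its generic point, read in `X(Ω)` by ★ D1
`IntegralModel.modelPointsEquiv`, reduces (★ `extendPoint_restrictPoint`: uniqueness in the valuative criterion) to a `κ̄(v)`-point over `x̃`.

* §1 `exists_hom_specValuationSubring_base_closedPoint_eq` — the `R`-point through a closed point of the special fibre of a FLAT `𝓞ᵥ`-scheme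
  locally of finite type (no properness).
* `AlgPoints.isClosed_singleton_pt_of_isAlgebraic` — points of a separated `k`-scheme with values in an algebraic extension are closed.
* §2 `IntegralModel.fst_base_pt_reductionPoint`, `IntegralModel.fst_base_pt_geomReductionMap_modelPointsEquiv_restrictPoint` (D1 readings),
  **`IntegralModel.exists_geomReductionMap_pt_eq`** — the head.

References: [Liu2002] Q. Liu, *Algebraic Geometry and Arithmetic Curves*, §10.1.3 Prop. 10.1.36, Cor. 10.1.38; [Hartshorne1977] II.4.7, II.3;
[SerreTate1968] §1 (reduction map); [GortzWedhorn2020] Prop. 3.33.  HC_CM is proved only modulo the 7 printed citations until rung 0 closes.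
-/

set_option autoImplicit false

-- `𝒳.reductionAt = (Over.pullback (specResidueField v)).obj 𝒳.total` and `(specRingHomOver R f g).left = Spec k` are definitional only
-- above `instances` transparency (as in `IntegralModelReductionMap` / `ProperIntegralPointsTwist`).
set_option backward.isDefEq.respectTransparency false

noncomputable section

open CategoryTheory CategoryTheory.Limits AlgebraicGeometry IsDedekindDomain IsDedekindDomain.HeightOneSpectrum
open IsLocalRing Field NumberField
open scoped Pointwise
open Literature.NumberTheory.EllipticCurves (genericFibre specGenericPoint)
open Literature.NumberTheory.GaloisRepresentations
open Literature.NumberTheory.DiophantineGeometry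

namespace Literature.AlgebraicGeometry.Motives

variable {K : Type} [Field K] [NumberField K] (v : HeightOneSpectrum (𝓞 K))

/-! ### §1 The `R`-point of a flat `𝓞ᵥ`-scheme of finite type through a closed point of the special fibre -/

/-- `s ∈ 𝔫_x ↔ germ_x s ∈ 𝔪_{X,x}` for the prime `𝔫_x = hU.primeIdealOf x` of `Γ(X, U)` at a point `x` of an affine open `U`.
[cite: Hartshorne1977, II Prop. 2.2] -/
private theorem mem_primeIdealOf_asIdeal_iff {X : Scheme.{0}} {U : X.Opens} (hU : IsAffineOpen U) (x : U) (s : Γ(X, U)) :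
    s ∈ (hU.primeIdealOf x).asIdeal ↔ (X.presheaf.germ U x.1 x.2).hom s ∈ maximalIdeal (X.presheaf.stalk x.1) := by
  rw [IsAffineOpen.primeIdealOf_eq_map_closedPoint]
  exact Iff.rfl

/-- On `Spec O`: if `ϖ ∈ p`, the global section `ϖ` lies in the prime of `Γ(Spec O, ⊤)` at `p` (its germ `toStalk O p ϖ` is not a unit:
it maps to `ϖ ∈ p O_p`). [cite: Hartshorne1977, II Prop. 2.2] -/
private theorem ΓSpecIso_inv_mem_primeIdealOf_top {O : Type} [CommRing O] (p : PrimeSpectrum O) (ϖ : O) (hϖ : ϖ ∈ p.asIdeal) :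
    (Scheme.ΓSpecIso (CommRingCat.of O)).inv.hom ϖ ∈
      ((isAffineOpen_top (Spec (CommRingCat.of O))).primeIdealOf ⟨p, trivial⟩).asIdeal := by
  rw [mem_primeIdealOf_asIdeal_iff, IsLocalRing.mem_maximalIdeal, mem_nonunits_iff]
  -- `germ_p ((ΓSpecIso O).inv ϖ) = toStalk O p ϖ = algebraMap O (𝒪_{Spec O, p}) ϖ`, and the stalk is `O_p`
  change ¬IsUnit ((StructureSheaf.toStalk O p).hom ϖ)
  rw [← StructureSheaf.stalkAlgebra_map, IsLocalization.AtPrime.isUnit_to_map_iff ((Spec.structureSheaf O).presheaf.stalk p) p.asIdeal ϖ]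
  exact fun h => h hϖ

/-- **An `R`-point through a closed point of the special fibre** ([Liu2002] Cor. 10.1.38, `R = 𝒪_{\overline{K_v}}`): for an `𝓞ᵥ`-scheme
`𝒳` FLAT and locally of finite type and a CLOSED point `x` of `𝒳` over the closed point of `Spec 𝓞ᵥ`, there is an `𝓞ᵥ`-morphism
`ρ : Spec R → 𝒳` sending the closed point to `x`.  Affine-locally `x ↔ 𝔫` maximal in `A = Γ(U)` with `ϖ ∈ 𝔫` (`𝔫 ∩ 𝓞ᵥ ∋ ϖ`), `ϖ`
`A`-regular (flatness): ★ (b1) `exists_prime_le_isAlgebraic_quotient` gives `q ≤ 𝔫`, `ϖ ∉ q`, `A ⧸ q` ALGEBRAIC over `𝓞ᵥ`; (b2) in the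
prime form `exists_ringHom_closureValuationSubring_comap_eq` gives `e : A ⧸ q → R` over `𝓞ᵥ` with centre `𝔫 ⧸ q`; `ρ = Spec (e ∘ (A → A⧸q)) ≫ (U ↪ 𝒳)`.
[cite: Liu2002, Prop. 10.1.36 and Cor. 10.1.38] [cite: Hartshorne1977, II.4.7] -/
theorem exists_hom_specValuationSubring_base_closedPoint_eq (𝒳 : SchemeOver (valuationSubringAtPrime K v))
    [LocallyOfFiniteType 𝒳.hom] [Flat 𝒳.hom] (x : 𝒳.left) (hx : IsClosed ({x} : Set 𝒳.left))
    (hxv : 𝒳.hom.base x = closedPoint (valuationSubringAtPrime K v)) :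
    ∃ ρ : specValuationSubring (closureValuationSubring (v.adicCompletion K)) (toClosureValuationSubring v) ⟶ 𝒳,
      ρ.left.base (closedPoint (closureValuationSubring (v.adicCompletion K))) = x := by
  classical
  -- (0) an affine open `U ∋ x`, `A = Γ(U)` as an `𝓞ᵥ`-algebra through `𝒳 → Spec 𝓞ᵥ`
  obtain ⟨_, ⟨U, hU, rfl⟩, hxU, -⟩ := 𝒳.left.isBasis_affineOpens.exists_subset_of_mem_open (Set.mem_univ x) isOpen_univ
  have hle : U ≤ 𝒳.hom ⁻¹ᵁ ⊤ := le_top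
  let φ : valuationSubringAtPrime K v →+* Γ(𝒳.left, U) :=
    (𝒳.hom.appLE ⊤ U hle).hom.comp (Scheme.ΓSpecIso (CommRingCat.of (valuationSubringAtPrime K v))).inv.hom
  letI : Algebra (valuationSubringAtPrime K v) Γ(𝒳.left, U) := φ.toAlgebra
  have hφ : ∀ a, algebraMap (valuationSubringAtPrime K v) Γ(𝒳.left, U) a =
      (𝒳.hom.appLE ⊤ U hle).hom ((Scheme.ΓSpecIso (CommRingCat.of (valuationSubringAtPrime K v))).inv.hom a) := fun _ => rfl
  -- finite type (`𝒳` lft), hence noetherian; flat (`𝒳` flat)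
  have hbij : Function.Bijective (Scheme.ΓSpecIso (CommRingCat.of (valuationSubringAtPrime K v))).inv.hom :=
    (Scheme.ΓSpecIso (CommRingCat.of (valuationSubringAtPrime K v))).commRingCatIsoToRingEquiv.symm.bijective
  have hsurj : Function.Surjective (Scheme.ΓSpecIso (CommRingCat.of (valuationSubringAtPrime K v))).inv.hom := hbij.2
  haveI : Algebra.FiniteType (valuationSubringAtPrime K v) Γ(𝒳.left, U) :=
    (HasRingHomProperty.appLE @LocallyOfFiniteType (f := 𝒳.hom) inferInstance ⟨⊤, isAffineOpen_top _⟩ ⟨U, hU⟩ hle).comp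
      (RingHom.FiniteType.of_surjective _ hsurj)
  haveI : IsNoetherianRing Γ(𝒳.left, U) := Algebra.FiniteType.isNoetherianRing (valuationSubringAtPrime K v) _
  haveI : Module.Flat (valuationSubringAtPrime K v) Γ(𝒳.left, U) :=
    RingHom.Flat.comp (RingHom.Flat.of_bijective hbij)
      (HasRingHomProperty.appLE @Flat (f := 𝒳.hom) inferInstance ⟨⊤, isAffineOpen_top _⟩ ⟨U, hU⟩ hle)
  -- (1) the maximal ideal `𝔫` of `x` in `A`, containing a non-zero `ϖ ∈ 𝔪ᵥ`
  let 𝔫 : Ideal Γ(𝒳.left, U) := (hU.primeIdealOf ⟨x, hxU⟩).asIdeal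
  haveI h𝔫max : 𝔫.IsMaximal := by
    rw [← PrimeSpectrum.isClosed_singleton_iff_isMaximal]
    have hinj : Function.Injective hU.fromSpec.base := hU.fromSpec.isOpenEmbedding.injective
    have hpre : hU.fromSpec.base ⁻¹' {x} = {hU.primeIdealOf ⟨x, hxU⟩} := by
      ext p
      simp only [Set.mem_preimage, Set.mem_singleton_iff]
      constructor
      · intro hp
        apply hinj
        rw [hp, IsAffineOpen.fromSpec_primeIdealOf]
      · rintro rfl
        exact hU.fromSpec_primeIdealOf ⟨x, hxU⟩
    rw [← hpre]
    exact hx.preimage hU.fromSpec.base.hom.continuous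
  obtain ⟨a, ha, ha0⟩ := Submodule.exists_mem_ne_zero_of_ne_bot v.ne_bot
  let ϖ : valuationSubringAtPrime K v := algebraMap (𝓞 K) _ a
  have hϖ0 : ϖ ≠ 0 := fun h => ha0 (by
    have hinj : Function.Injective (algebraMap (𝓞 K) (valuationSubringAtPrime K v)) :=
      fun b c hbc => IsFractionRing.injective (𝓞 K) K (by
        simpa only [← IsScalarTower.algebraMap_apply] using congrArg (algebraMap (valuationSubringAtPrime K v) K) hbc)
    exact hinj (h.trans (map_zero _).symm))
  have hϖm : ϖ ∈ maximalIdeal (valuationSubringAtPrime K v) :=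
    (IsLocalization.AtPrime.to_map_mem_maximal_iff (valuationSubringAtPrime K v) v.asIdeal a).2 ha
  have hreg : algebraMap (valuationSubringAtPrime K v) Γ(𝒳.left, U) ϖ ∈ nonZeroDivisors Γ(𝒳.left, U) := by
    have h : IsSMulRegular Γ(𝒳.left, U) ϖ := Module.Flat.isSMulRegular_of_nonZeroDivisors (mem_nonZeroDivisors_of_ne_zero hϖ0)
    rw [mem_nonZeroDivisors_iff_right]
    intro y hy
    rw [mul_comm, ← Algebra.smul_def] at hy
    exact h (show ϖ • y = ϖ • 0 by rw [hy, smul_zero])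
  -- `𝔪ᵥ A ⊆ 𝔫`: `x` lies over the closed point
  have hm𝔫 : ∀ b ∈ maximalIdeal (valuationSubringAtPrime K v), algebraMap (valuationSubringAtPrime K v) Γ(𝒳.left, U) b ∈ 𝔫 := by
    intro b hb
    rw [hφ]
    change _ ∈ ((hU.primeIdealOf ⟨x, hxU⟩).comap (𝒳.hom.appLE ⊤ U hle).hom).asIdeal
    rw [IsAffineOpen.comap_primeIdealOf_appLE ⊤ (isAffineOpen_top _) U hU hle hxU]
    exact ΓSpecIso_inv_mem_primeIdealOf_top (𝒳.hom.base x) b (by rw [hxv]; exact hb)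
  have hϖ𝔫 : algebraMap (valuationSubringAtPrime K v) Γ(𝒳.left, U) ϖ ∈ 𝔫 := hm𝔫 ϖ hϖm
  -- (2) ★ (b1): a prime `q ≤ 𝔫`, `ϖ ∉ q`, with `A ⧸ q` algebraic over `𝓞ᵥ`
  obtain ⟨q, hq, hq𝔫, hϖq, -, halg⟩ :=
    Literature.RingTheory.Flat.exists_prime_le_isAlgebraic_quotient (R := valuationSubringAtPrime K v) hreg 𝔫 hϖ𝔫
  haveI := hq
  haveI := halg
  -- `𝓞ᵥ → A ⧸ q` is injective: its kernel is a prime of the DVR `𝓞ᵥ` not containing `ϖ`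
  haveI : FaithfulSMul (valuationSubringAtPrime K v) (Γ(𝒳.left, U) ⧸ q) := by
    rw [faithfulSMul_iff_algebraMap_injective, RingHom.injective_iff_ker_eq_bot]
    by_contra hker
    have hprime : (RingHom.ker (algebraMap (valuationSubringAtPrime K v) (Γ(𝒳.left, U) ⧸ q))).IsPrime := RingHom.ker_isPrime _
    have hmax := hprime.isMaximal hker
    have hϖker : ϖ ∈ RingHom.ker (algebraMap (valuationSubringAtPrime K v) (Γ(𝒳.left, U) ⧸ q)) := by
      rw [IsLocalRing.eq_maximalIdeal hmax]; exact hϖm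
    rw [RingHom.mem_ker, IsScalarTower.algebraMap_apply (valuationSubringAtPrime K v) Γ(𝒳.left, U) (Γ(𝒳.left, U) ⧸ q),
      Ideal.Quotient.algebraMap_eq, Ideal.Quotient.eq_zero_iff_mem] at hϖker
    exact hϖq hϖker
  -- the prime `𝔫 ⧸ q` of `A ⧸ q` lies over `𝔪ᵥ`
  let 𝔮 : Ideal (Γ(𝒳.left, U) ⧸ q) := 𝔫.map (Ideal.Quotient.mk q)
  haveI : 𝔮.IsPrime := Ideal.map_isPrime_of_surjective Ideal.Quotient.mk_surjective (by rwa [Ideal.mk_ker])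
  have h𝔮𝔫 : 𝔮.comap (Ideal.Quotient.mk q) = 𝔫 := by
    rw [Ideal.comap_map_of_surjective _ Ideal.Quotient.mk_surjective, ← RingHom.ker_eq_comap_bot, Ideal.mk_ker, sup_eq_left.2 hq𝔫]
  have h𝔮 : 𝔮.comap (algebraMap (valuationSubringAtPrime K v) (Γ(𝒳.left, U) ⧸ q)) = maximalIdeal (valuationSubringAtPrime K v) := by
    have h1 : 𝔮.comap (algebraMap (valuationSubringAtPrime K v) (Γ(𝒳.left, U) ⧸ q)) =
        𝔫.comap (algebraMap (valuationSubringAtPrime K v) Γ(𝒳.left, U)) := by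
      rw [IsScalarTower.algebraMap_eq (valuationSubringAtPrime K v) Γ(𝒳.left, U) (Γ(𝒳.left, U) ⧸ q), ← Ideal.comap_comap,
        Ideal.Quotient.algebraMap_eq, h𝔮𝔫]
    rw [h1]
    exact ((IsLocalRing.maximalIdeal.isMaximal _).eq_of_le
      (inferInstance : (𝔫.comap (algebraMap (valuationSubringAtPrime K v) Γ(𝒳.left, U))).IsPrime).ne_top
      fun b hb => Ideal.mem_comap.2 (hm𝔫 b hb)).symm
  -- (3) (b2), prime form: `e : A ⧸ q → R` over `𝓞ᵥ` with centre `𝔮`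
  obtain ⟨e, he, he𝔮⟩ := exists_ringHom_closureValuationSubring_comap_eq v 𝔮 h𝔮
  let g : Γ(𝒳.left, U) →+* closureValuationSubring (v.adicCompletion K) := e.comp (Ideal.Quotient.mk q)
  have hg : g.comp (algebraMap (valuationSubringAtPrime K v) Γ(𝒳.left, U)) = toClosureValuationSubring v := by
    rw [RingHom.comp_assoc]; exact he
  have hg𝔫 : (maximalIdeal _).comap g = 𝔫 := by
    rw [← Ideal.comap_comap, he𝔮, h𝔮𝔫]
  -- (4) `ρ = Spec g ≫ (Spec A = U ↪ 𝒳)` over `𝓞ᵥ`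
  refine ⟨Over.homMk (Spec.map (CommRingCat.ofHom g) ≫ hU.fromSpec) ?_, ?_⟩
  · change (Spec.map (CommRingCat.ofHom g) ≫ hU.fromSpec) ≫ 𝒳.hom = Spec.map (CommRingCat.ofHom (toClosureValuationSubring v))
    rw [Category.assoc, ← IsAffineOpen.SpecMap_appLE_fromSpec 𝒳.hom (isAffineOpen_top _) hU hle, IsAffineOpen.fromSpec_top,
      Scheme.isoSpec_Spec_inv, ← Spec.map_comp, ← Spec.map_comp, ← hg]
    rfl
  · change hU.fromSpec.base ((Spec.map (CommRingCat.ofHom g)).base (closedPoint _)) = x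
    have : (Spec.map (CommRingCat.ofHom g)).base (closedPoint (closureValuationSubring (v.adicCompletion K))) =
        hU.primeIdealOf ⟨x, hxU⟩ := PrimeSpectrum.ext hg𝔫
    rw [this, IsAffineOpen.fromSpec_primeIdealOf]

/-- **The point of an algebraic point is closed**: for `Y` locally of finite type over a field `k`, an `L`-point with `L` ALGEBRAIC over
`k` has closed underlying point (its residue field embeds in `L`, hence is algebraic over `k`). [cite: GortzWedhorn2020, Prop. 3.33] -/
theorem AlgPoints.isClosed_singleton_pt_of_isAlgebraic {k : Type} [Field k] {Y : SchemeOver k} [IsSeparated Y.hom]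
    {L : Type} [Field L] [Algebra k L] [Algebra.IsAlgebraic k L] (z : AlgPoints Y L) : IsClosed ({z.pt} : Set Y.left) := by
  -- `Spec L → Spec k` is integral, hence so is `Spec L → Y` (`Y` separated); integral morphisms are closed maps
  haveI : IsIntegralHom (z.left ≫ Y.hom) := by
    rw [Over.w z]
    exact IsIntegralHom.SpecMap_iff.2 (Algebra.IsIntegral.isIntegral (R := k) (A := L) |> fun h => h)
  haveI : IsIntegralHom z.left := IsIntegralHom.of_comp z.left Y.hom
  haveI : Unique ↥(specOver k L).left := inferInstanceAs (Unique (PrimeSpectrum L))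
  have hr : Set.range z.left.base = {z.pt} := by
    rw [Set.range_unique]
    congr 1
    exact congrArg z.left.base (Subsingleton.elim _ _)
  rw [← hr]
  exact z.left.isClosedMap.isClosed_range

/-! ### §2 Reading in the reduction map of a proper model -/

variable {v} {X : SchemeOver K}

/-- The transpose of `u : U → 𝒳` (`U` a `κ(v)`-scheme viewed over `𝓞ᵥ`) along `Over.mapPullbackAdj` has first component `u`,
on underlying schemes. [cite: Hartshorne1977, II.3 Thm. 3.3 (fibre product, universal property)] -/
private theorem mapPullbackAdj_homEquiv_left_comp_fst' {S S' : Scheme.{0}} (g : S' ⟶ S) (U : Over S') (𝒳 : Over S)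
    (u : (Over.map g).obj U ⟶ 𝒳) :
    ((Over.mapPullbackAdj g).homEquiv U 𝒳 u).left ≫ pullback.fst 𝒳.hom g = u.left := by
  simp [Over.mapPullbackAdj]

/-- **The underlying point of `reductionPoint y`** is the image of the closed point of `Spec R` under the `R`-point read through
`y : Spec κ(R) → 𝒳`: `fst (r_𝒳 y).pt = y(pt)`. [cite: Hartshorne1977, II.3 Thm. 3.3 (fibre product, universal property)] -/
theorem IntegralModel.fst_base_pt_reductionPoint (𝒳 : IntegralModel (valuationSubringAtPrime K v) K X)
    (y : residueFieldPoints 𝒳.total) :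
    (pullback.fst 𝒳.total.hom (specResidueField v)).base (𝒳.reductionPoint y).pt =
      y.left.base (closedPoint (ResidueField (closureValuationSubring (v.adicCompletion K)))) := by
  change ((𝒳.reductionPoint y).left ≫ pullback.fst 𝒳.total.hom (specResidueField v)).base (closedPoint _) = _
  rw [IntegralModel.reductionPoint, mapPullbackAdj_homEquiv_left_comp_fst', Over.comp_left, Over.comp_left,
    Scheme.Hom.comp_base, Scheme.Hom.comp_base, TopCat.comp_app, TopCat.comp_app]
  haveI : Subsingleton ↥(Over.left (specRingHomOver (closureValuationSubring (v.adicCompletion K)) (toClosureValuationSubring v)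
      (residue (closureValuationSubring (v.adicCompletion K))))) :=
    inferInstanceAs (Subsingleton (PrimeSpectrum (ResidueField (closureValuationSubring (v.adicCompletion K)))))
  congr 1
  exact Subsingleton.elim _ _

/-- **Reading an `R`-point in the reduction map**: for a PROPER model `𝒳` and an `R`-point `ρ : Spec R → 𝒳` over `𝓞ᵥ`, the reduction of
the `Ω`-point `ρ|_{Spec Ω}` (read in `X(Ω)` by `modelPointsEquiv`) has underlying point the image of the closed point of `Spec R` under `ρ`
(uniqueness in the valuative criterion: `extendPoint (restrictPoint ρ) = ρ`). [cite: Hartshorne1977, II.4.7] [cite: SerreTate1968, §1] -/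
theorem IntegralModel.fst_base_pt_geomReductionMap_modelPointsEquiv_restrictPoint
    (𝒳 : IntegralModel (valuationSubringAtPrime K v) K X) [IsProper 𝒳.total.hom]
    (ρ : specValuationSubring (closureValuationSubring (v.adicCompletion K)) (toClosureValuationSubring v) ⟶ 𝒳.total) :
    (pullback.fst 𝒳.total.hom (specResidueField v)).base
        (𝒳.geomReductionMap (𝒳.modelPointsEquiv
          (restrictPoint (closureValuationSubring (v.adicCompletion K)) (toClosureValuationSubring v) 𝒳.total ρ))).pt =
      ρ.left.base (closedPoint (closureValuationSubring (v.adicCompletion K))) := by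
  rw [IntegralModel.geomReductionMap_def, Equiv.symm_apply_apply, extendPoint_restrictPoint,
    IntegralModel.fst_base_pt_reductionPoint, Over.comp_left, Scheme.Hom.comp_apply]
  congr 1
  exact IsLocalRing.comap_closedPoint (IsLocalRing.residue (closureValuationSubring (v.adicCompletion K)))

/-- **The reduction map of a proper flat model is surjective onto the CLOSED POINTS of the special fibre** ([Liu2002] Cor. 10.1.38):
for `𝒳` a proper flat model of `X` over `𝓞ᵥ` and a `κ̄(v)`-point `z` of the special fibre `𝒳_v`, some `Ω = \overline{K_v}`-point `x` of
`X` reduces to a `κ̄(v)`-point with the same underlying (closed) point as `z`.  (The two `κ̄(v)`-points over that closed point then differ by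
an automorphism of `κ̄(v)` over `κ(v)`.)  Assembly: §1 at the closed point `xt = fst(z.pt)` of `𝒳.total` + the reading above + injectivity of
the closed immersion `𝒳_v → 𝒳`. [cite: Liu2002, Cor. 10.1.38] [cite: SerreTate1968, §1] -/
theorem IntegralModel.exists_geomReductionMap_pt_eq (𝒳 : IntegralModel (valuationSubringAtPrime K v) K X)
    [IsProper 𝒳.total.hom] [Flat 𝒳.total.hom] (z : AlgPoints 𝒳.reductionAt (geomResidueField v)) :
    ∃ x : AlgPoints X (AlgebraicClosure (v.adicCompletion K)), (𝒳.geomReductionMap x).pt = z.pt := by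
  -- the closed point `xt` of the total space under `z`
  set xt : 𝒳.total.left := (pullback.fst 𝒳.total.hom (specResidueField v)).base z.pt with hxt
  -- the closed immersion `𝒳_v → 𝒳` (base change of `Spec κ(v) → Spec 𝓞ᵥ`)
  haveI : IsClosedImmersion (specResidueField v) :=
    IsClosedImmersion.spec_of_surjective _ (residueAt_surjective v)
  haveI : IsClosedImmersion (pullback.fst 𝒳.total.hom (specResidueField v)) := inferInstance
  have hinj : Function.Injective (pullback.fst 𝒳.total.hom (specResidueField v)).base :=
    (pullback.fst 𝒳.total.hom (specResidueField v)).isClosedEmbedding.injective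
  -- `xt` is closed and lies over the closed point of `Spec 𝓞ᵥ`
  have hzclosed : IsClosed ({z.pt} : Set 𝒳.reductionAt.left) := AlgPoints.isClosed_singleton_pt_of_isAlgebraic z
  have hxtclosed : IsClosed ({xt} : Set 𝒳.total.left) := by
    rw [hxt, ← Set.image_singleton]
    exact (pullback.fst 𝒳.total.hom (specResidueField v)).isClosedEmbedding.isClosedMap _ hzclosed
  have hxtv : 𝒳.total.hom.base xt = closedPoint (valuationSubringAtPrime K v) := by
    change (pullback.fst 𝒳.total.hom (specResidueField v) ≫ 𝒳.total.hom).base z.pt = _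
    rw [pullback.condition, Scheme.Hom.comp_base, TopCat.comp_app]
    -- every point of `Spec κ(v)` goes to the closed point of `Spec 𝓞ᵥ`
    haveI : Subsingleton ↥(Spec (CommRingCat.of v.asIdeal.ResidueField)) :=
      inferInstanceAs (Subsingleton (PrimeSpectrum v.asIdeal.ResidueField))
    rw [Subsingleton.elim ((pullback.snd 𝒳.total.hom (specResidueField v)).base z.pt) (⊥ : PrimeSpectrum v.asIdeal.ResidueField)]
    apply PrimeSpectrum.ext
    change Ideal.comap (residueAt v) ⊥ = maximalIdeal _
    rw [← RingHom.ker, residueAt, RingHom.ker_equiv_comp, IsLocalRing.ker_residue]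
  obtain ⟨ρ, hρ⟩ := exists_hom_specValuationSubring_base_closedPoint_eq v 𝒳.total xt hxtclosed hxtv
  refine ⟨𝒳.modelPointsEquiv (restrictPoint _ _ 𝒳.total ρ), hinj ?_⟩
  rw [IntegralModel.fst_base_pt_geomReductionMap_modelPointsEquiv_restrictPoint, hρ]

end Literature.AlgebraicGeometry.Motives

end
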